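import Summits.QuantumFields.YangMills.Theorems.BalabanLadderROTSingleAngle
import HarnessLib

/-!
# Crux `ROT` (stmt-QuantumFields-20042): commensurability of King's two-lattice comparison with the odd tori of the schemes

Helper file (`--supports stmt-QuantumFields-20042 --as helper`) of the fleet lead `ym-spine-20042-p1` (generation g2); companion of
`Theorems/BalabanLadderROTGuardIR.lean` and of the located finding `FINDING-20042-IR-guard.md` (evidence on the item).

King's mechanism for the rotation leg (C. King, Commun. Math. Phys. **103** (1986) 323–349, §2 p. 326–327 and §4 (4.1)) compares
the lattice theory with its copy on a lattice rotated by a Pythagorean angle ON ONE TORUS FITTED BY BOTH LATTICES: «since the length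
of each side of `D_J` is a multiple of 25, we see that `D_J` is also fitted by the rotated lattice» (p. 327).  In the tree's vocabulary
the lattice is `ℤ⁴` with period lattice `(2L+1)·ℤ⁴` (odd tori `(ℤ/(2L+1))⁴`, `wilsonTorusMean`, `latticeDist`), and the rotation of
the `(x₀,x₁)`-plane is `planeRot (0 : Fin 3) θ`; the rotated lattice `R_θ⁻¹ ℤ⁴` is `(2L+1)·ℤ⁴`-periodic iff `R_θ` maps the period
lattice `(2L+1)·ℤ⁴` into `ℤ⁴`.  This file records, kernel-checked:

* `planeRot_kingAngle_maps_five_mul` — King's angle `θ₀ = arcsin (3/5)` (`cos θ₀ = 4/5`): `R_{θ₀}` maps `5·ℤ⁴` into `ℤ⁴` (the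
  `(3,4,5)` pair; so every odd torus of side `2L+1 ≡ 0 (mod 5)` is fitted by both lattices);
* `sq_add_sq_eq_pow_nine` — `p² + q² = 9^j` in integers forces `p = 0 ∨ q = 0` (descent mod 3);
* `cos_eq_zero_or_sin_eq_zero_of_pow_three_mul_mem` / **`planeRot_maps_pow_three_mul_only_if_axis`** — on the odd tori of side
  `3^j` NO planar rotation outside the hypercubic group maps the period lattice into the site lattice: if `R_θ (3^j·ℤ⁴) ⊆ ℤ⁴` then
  `cos θ = 0 ∨ sin θ = 0`.

Consequence recorded in the finding: the crux `ROT` / the registered `KingLimit` quantify over EVERY admissible scheme (range clause only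
`14 ≤ L_k`, `a_k⁻² ≤ L_k`), in particular over tori of side `3^{j_k}`, along which King's fixed-torus comparison has no common torus at
ANY useful angle; there the two-orientation comparison must change the global volume, i.e. it needs finite-size insensitivity of the
local centred correlations — an infrared input (`GapInUnits`), see `BalabanLadderROTGuardIR.lean`.

Elementary number theory and coordinates of `planeRot`; no definition, no named fact, no sorry; standard axioms.  NOT progress on E1.
-/

set_option autoImplicit false

noncomputable section

open Real
open Literature.MathematicalPhysics.QuantumFieldTheory
open Summit.QuantumFields.YangMills.Theorems.NPointIsotropy.Negative (E4)

namespace Summit.QuantumFields.YangMills.Theorems.ROT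

/-! ## §1 King's angle fits the tori of side `≡ 0 (mod 5)` -/

/-- `sin (arcsin (3/5)) = 3/5`. [folklore] -/
theorem sin_arcsin_three_fifths : Real.sin (Real.arcsin (3 / 5)) = 3 / 5 :=
  Real.sin_arcsin (by norm_num) (by norm_num)

/-- **King's `(3,4,5)` rotation maps `5·ℤ⁴` into `ℤ⁴`**: for `θ₀ = arcsin (3/5)` (`cos θ₀ = 4/5`, `sin θ₀ = 3/5`) and every
`v ∈ E4` with coordinates in `5·ℤ`, `planeRot 0 θ₀ v` has integer coordinates (`(5m₀, 5m₁) ↦ (4m₀ + 3m₁, −3m₀ + 4m₁)` in the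
`(x₀,x₁)`-plane, the other coordinates unchanged).  So the rotated lattice fits every odd torus of side `2L+1 ≡ 0 (mod 5)` — King's
«each side a multiple of 25 (hence of 5)». [C. King, CMP 103 (1986) p. 326–327, Fig. 1 — setting] -/
theorem planeRot_kingAngle_maps_five_mul (v : E4) (hv : ∀ i, ∃ m : ℤ, v i = 5 * m) (i : Fin 4) :
    ∃ m : ℤ, planeRot (0 : Fin 3) (Real.arcsin (3 / 5)) v i = m := by
  obtain ⟨m₀, h₀⟩ := hv 0
  obtain ⟨m₁, h₁⟩ := hv 1
  rw [planeRot_apply, cos_arcsin_three_fifths, sin_arcsin_three_fifths]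
  have hs : ((0 : Fin 3).succ : Fin 4) = 1 := rfl
  by_cases hi0 : i = 0
  · subst hi0
    refine ⟨4 * m₀ + 3 * m₁, ?_⟩
    simp only [if_true, hs, h₀, h₁]
    push_cast
    ring
  · by_cases hi1 : i = 1
    · subst hi1
      refine ⟨-3 * m₀ + 4 * m₁, ?_⟩
      simp only [hs, h₀, h₁]
      push_cast
      norm_num
      ring
    · obtain ⟨m, hm⟩ := hv i
      refine ⟨5 * m, ?_⟩
      rw [hs]
      simp only [hi0, hi1, if_false]
      rw [hm]
      push_cast
      ring

/-! ## §2 No commensurate planar rotation on the tori of side `3^j` -/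

/-- Squares modulo `3`: `x² + y² ≡ 0 (mod 3)` forces `x ≡ y ≡ 0`. [folklore] -/
theorem zmod3_sq_add_sq_eq_zero {x y : ZMod 3} (h : x ^ 2 + y ^ 2 = 0) : x = 0 ∧ y = 0 := by
  revert x y h
  decide

/-- **`p² + q² = 9^j ⇒ p = 0 ∨ q = 0`** (in `ℤ`): `3` is not a sum of two coprime squares — descent modulo `3`. [folklore] -/
theorem sq_add_sq_eq_pow_nine {j : ℕ} : ∀ {p q : ℤ}, p ^ 2 + q ^ 2 = 9 ^ j → p = 0 ∨ q = 0 := by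
  induction j with
  | zero =>
    intro p q h
    rw [pow_zero] at h
    by_cases hp : p = 0
    · exact Or.inl hp
    by_cases hq : q = 0
    · exact Or.inr hq
    have hp' : 0 < p ^ 2 := lt_of_le_of_ne (sq_nonneg p) (Ne.symm (pow_ne_zero 2 hp))
    have hq' : 0 < q ^ 2 := lt_of_le_of_ne (sq_nonneg q) (Ne.symm (pow_ne_zero 2 hq))
    exfalso
    linarith
  | succ j ih =>
    intro p q h
    have h3 : ((p : ZMod 3)) ^ 2 + ((q : ZMod 3)) ^ 2 = 0 := by
      have hc := congrArg (fun z : ℤ => (z : ZMod 3)) h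
      simp only [Int.cast_add, Int.cast_pow] at hc
      rw [hc, pow_succ]
      have h9 : ((9 : ℤ) : ZMod 3) = 0 := by decide
      rw [h9, mul_zero]
    obtain ⟨hp, hq⟩ := zmod3_sq_add_sq_eq_zero h3
    obtain ⟨p', rfl⟩ := (ZMod.intCast_zmod_eq_zero_iff_dvd p 3).1 hp
    obtain ⟨q', rfl⟩ := (ZMod.intCast_zmod_eq_zero_iff_dvd q 3).1 hq
    have h' : p' ^ 2 + q' ^ 2 = 9 ^ j := by
      have e : (9 : ℤ) ^ (j + 1) = 9 * 9 ^ j := pow_succ' 9 j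
      have : (9 : ℤ) * (p' ^ 2 + q' ^ 2) = 9 * 9 ^ j := by
        push_cast at h
        linear_combination h + e
      exact mul_left_cancel₀ (by norm_num) this
    rcases ih h' with hp' | hq'
    · left; rw [hp']; ring
    · right; rw [hq']; ring

/-- **If `3^j · cos θ` and `3^j · sin θ` are integers then `cos θ = 0 ∨ sin θ = 0`** (`(3^j cos θ)² + (3^j sin θ)² = 9^j`).
[folklore] -/
theorem cos_eq_zero_or_sin_eq_zero_of_pow_three_mul_mem {j : ℕ} {θ : ℝ} {p q : ℤ}
    (hp : (3 : ℝ) ^ j * Real.cos θ = p) (hq : (3 : ℝ) ^ j * Real.sin θ = q) :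
    Real.cos θ = 0 ∨ Real.sin θ = 0 := by
  have hsum : (p : ℝ) ^ 2 + (q : ℝ) ^ 2 = (9 : ℝ) ^ j := by
    rw [← hp, ← hq]
    have h1 := Real.cos_sq_add_sin_sq θ
    have h9 : (9 : ℝ) ^ j = ((3 : ℝ) ^ j) ^ 2 := by
      rw [← pow_mul, show (9 : ℝ) = 3 ^ 2 by norm_num, ← pow_mul, mul_comm]
    rw [h9]
    nlinarith [h1]
  have hint : p ^ 2 + q ^ 2 = 9 ^ j := by exact_mod_cast hsum
  have h3 : (3 : ℝ) ^ j ≠ 0 := pow_ne_zero _ (by norm_num)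
  rcases sq_add_sq_eq_pow_nine hint with h0 | h0
  · left
    have : (3 : ℝ) ^ j * Real.cos θ = 0 := by rw [hp, h0]; simp
    exact (mul_eq_zero.1 this).resolve_left h3
  · right
    have : (3 : ℝ) ^ j * Real.sin θ = 0 := by rw [hq, h0]; simp
    exact (mul_eq_zero.1 this).resolve_left h3

/-- **On a torus of side `3^j` the only planar rotations fitting the lattice are hypercubic**: if the rotation `R_θ` of the
`(x₀,x₁)`-plane maps the period lattice `3^j · ℤ⁴` into the site lattice `ℤ⁴` (i.e. the rotated lattice `R_θ⁻¹ ℤ⁴` is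
`3^j·ℤ⁴`-periodic, King's «the torus is also fitted by the rotated lattice»), then `cos θ = 0 ∨ sin θ = 0` — `θ ∈ (π/2)ℤ`, a
symmetry the lattice already has.  Since `3^j = 2L+1` is an admissible odd torus side for every `j` with `3^j ≥ 2·a_k⁻² + 1`,
King's fixed-torus two-lattice comparison (CMP 103 (1986) Thm 2.4) has NO common torus along such schemes at any useful angle.
[folklore] -/
theorem planeRot_maps_pow_three_mul_only_if_axis {j : ℕ} {θ : ℝ}
    (h : ∀ v : E4, (∀ i, ∃ m : ℤ, v i = (3 : ℝ) ^ j * m) → ∀ i, ∃ m : ℤ, planeRot (0 : Fin 3) θ v i = m) :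
    Real.cos θ = 0 ∨ Real.sin θ = 0 := by
  -- the period vector `3^j · e₀`
  set v : E4 := EuclideanSpace.single (0 : Fin 4) ((3 : ℝ) ^ j) with hv
  have hvi : ∀ i, ∃ m : ℤ, v i = (3 : ℝ) ^ j * m := by
    intro i
    by_cases hi : i = 0
    · subst hi
      exact ⟨1, by simp [hv]⟩
    · exact ⟨0, by simp [hv, hi]⟩
  have hs : ((0 : Fin 3).succ : Fin 4) = 1 := rfl
  have hv0 : v 0 = (3 : ℝ) ^ j := by simp [hv]
  have hv1 : v 1 = 0 := by simp [hv]
  obtain ⟨m₀, h₀⟩ := h v hvi 0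
  obtain ⟨m₁, h₁⟩ := h v hvi 1
  rw [planeRot_apply] at h₀ h₁
  simp only [if_true, hs, hv0, hv1, mul_zero, add_zero] at h₀
  simp only [hs, show (1 : Fin 4) ≠ 0 by decide, if_false, if_true, hv0, hv1, mul_zero, add_zero] at h₁
  refine cos_eq_zero_or_sin_eq_zero_of_pow_three_mul_mem (j := j) (p := m₀) (q := -m₁) ?_ ?_
  · rw [← h₀]; ring
  · rw [Int.cast_neg, ← h₁]; ring

end Summit.QuantumFields.YangMills.Theorems.ROT

end
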